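import Summits.Ventures.Crystal3D.Theorems.StickyWulffConstantPolycrystalWulffBoundTwoClassBallCut

/-!
# `PolycrystalWulffBound`, line `PolyDensity`: the CUT ROWS of the «top two classes + dust» LP —
# inradius bound per grain, ball cut on one class, TWO-BODY ball cut on two classes, isoperimetry of
# their union — in INTRINSIC form (crux `stmt-Ventures-19482`; lane poly-p2, gen 24)

Route `StickyWulffConstant` of the venture `Summits/Ventures/Crystal3D`, second prover lane.  For a
polyhedral crux texture (grains of finite perimeter and volume, pairwise disjoint — no wall law and no
twin-freeness is used here) and two grains `f₁, f₂` of different lattices (classes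
`C₁ = {f | A f Λ = A f₁ Λ}`, `C₂`, rest `R = (C₁ ∪ C₂)ᶜ`), writing `Fr f` for the free energy summand of
the crux energy, `Y f = per_{B̄(0,1)} − Σ_g ι_{B̄(0,1)}` for the exterior unit-ball area of a grain and
`w f g = ι_{B̄(0,1)}(G f, G g)` (`f ≠ g`) for the unit-ball interfaces — all INTRINSIC (no existential
packaging, so that rows proved in different files combine):

* INRADIUS   `0 ≤ Y f` and `√3·Y f ≤ Fr f` for every grain (`B̄(0,√3) ⊆ W`);  `0 ≤ w f g`;
* BALL CUT   `3·(π(24√3−32))^{1/3}·Vol^{2/3} ≤ Σ_{C₁} Fr + 2·Σ_{C₁ᶜ} Y` (body `W₁ ∩ B̄(0,2)`, as in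
  `…TwoClassBallCut`);
* TWO-BODY BALL CUT (new)  `3·26.61^{1/3}·Vol^{2/3} ≤ Σ_{C₁} Fr + Σ_{C₂} Fr + 2·Σ_R Y`: the symmetric
  convex body `L = W₁ ∩ W₂ ∩ B̄(0,2)` has `h_L ≤ h_{W₁}`, `h_L ≤ h_{W₂}`, `h_L ≤ 2`, and
  `|L| ≥ 2π(24√3−32) − 32π/3 ≥ 26.61` (inclusion–exclusion of the two masses inside `B̄(0,2)`,
  `volume_cruxWulffBody_inter_inter_closedBall_ge` below — the ball is KEPT, unlike `…WulffOverlapCap`);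
* ISOPERIMETRY of `C₁ ∪ C₂`  `3(4π/3)^{1/3}·|⋃_{C₁∪C₂} G|^{2/3} ≤ Σ_{C₁∪C₂} Y + Σ_{f ∈ C₁∪C₂} Σ_{g ∈ R} w f g`.

Companion `…TopTwoWulffRows` (per-class Wulff rows, dust, charged walls); consumer
`…RungTwinFreeAllClassesOne`.  WHAT THIS IS NOT: a rung; the crux is not claimed.
-/

noncomputable section

open scoped BigOperators InnerProductSpace ENNReal
open MeasureTheory Filter

namespace Summit.Ventures.Crystal3D.Cruxes.PolycrystalWulffBound.PolyDensity

open Summit.Ventures.Crystal3D.Theorems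
open Summit.Ventures.Crystal3D.Cruxes.TextureLiminf.TexShadow (per polytope E3 facetArea supportFn)
open Literature.MathematicalPhysics.StatisticalMechanics (perimeter fccStacking)

/-- **Two fcc Wulff bodies share `≥ 26.61` of volume INSIDE `B̄(0,2)`**: for every pair of frames,
`26.61 ≤ |W(A) ∩ W(B) ∩ B̄(0,2)|` (each body has mass `≥ π(24√3 − 32)` in the ball of volume `32π/3`). -/
theorem volume_cruxWulffBody_inter_inter_closedBall_ge (A B : E3 ≃ₗᵢ[ℝ] E3) :
    (26.61 : ℝ) ≤ (volume
      ({y : E3 | ∀ ν : E3, ⟪y, ν⟫_ℝ ≤ Real.sqrt 2 / 4 *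
          ∑ᶠ w ∈ {w | w ∈ fccStacking 1 (Real.sqrt (2 / 3)) ∧ ‖w‖ = 1}, |⟪w, A.symm ν⟫_ℝ|} ∩
       {y : E3 | ∀ ν : E3, ⟪y, ν⟫_ℝ ≤ Real.sqrt 2 / 4 *
          ∑ᶠ w ∈ {w | w ∈ fccStacking 1 (Real.sqrt (2 / 3)) ∧ ‖w‖ = 1}, |⟪w, B.symm ν⟫_ℝ|} ∩
       Metric.closedBall (0 : E3) 2)).toReal := by
  set W₁ : Set E3 := {y : E3 | ∀ ν : E3, ⟪y, ν⟫_ℝ ≤ Real.sqrt 2 / 4 *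
      ∑ᶠ w ∈ {w | w ∈ fccStacking 1 (Real.sqrt (2 / 3)) ∧ ‖w‖ = 1}, |⟪w, A.symm ν⟫_ℝ|} with hW₁
  set W₂ : Set E3 := {y : E3 | ∀ ν : E3, ⟪y, ν⟫_ℝ ≤ Real.sqrt 2 / 4 *
      ∑ᶠ w ∈ {w | w ∈ fccStacking 1 (Real.sqrt (2 / 3)) ∧ ‖w‖ = 1}, |⟪w, B.symm ν⟫_ℝ|} with hW₂
  set Bl : Set E3 := Metric.closedBall (0 : E3) 2 with hBl
  have hK₁ : ENNReal.ofReal (Real.pi * (24 * Real.sqrt 3 - 32)) ≤ volume (W₁ ∩ Bl) :=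
    volume_cruxWulffBody_inter_closedBall_two_ge A
  have hK₂ : ENNReal.ofReal (Real.pi * (24 * Real.sqrt 3 - 32)) ≤ volume (W₂ ∩ Bl) :=
    volume_cruxWulffBody_inter_closedBall_two_ge B
  have hBvol : volume Bl = ENNReal.ofReal (4 / 3 * Real.pi * 2 ^ 3) :=
    volume_closedBall_zero_E3 (by norm_num)
  have hmeas₂ : MeasurableSet (W₂ ∩ Bl) :=
    (isCompact_cruxWulffBody B).measurableSet.inter Metric.isClosed_closedBall.measurableSet
  have hIE : volume (W₁ ∩ Bl ∪ W₂ ∩ Bl) + volume (W₁ ∩ Bl ∩ (W₂ ∩ Bl)) =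
      volume (W₁ ∩ Bl) + volume (W₂ ∩ Bl) := measure_union_add_inter _ hmeas₂
  have hU : volume (W₁ ∩ Bl ∪ W₂ ∩ Bl) ≤ ENNReal.ofReal (4 / 3 * Real.pi * 2 ^ 3) := by
    rw [← hBvol]
    exact measure_mono (Set.union_subset Set.inter_subset_right Set.inter_subset_right)
  have hsub : W₁ ∩ Bl ∩ (W₂ ∩ Bl) ⊆ W₁ ∩ W₂ ∩ Bl := fun y hy => ⟨⟨hy.1.1, hy.2.1⟩, hy.1.2⟩
  have ha0 : 0 ≤ Real.pi * (24 * Real.sqrt 3 - 32) := by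
    have h3 := sqrt_three_lower_fine
    exact mul_nonneg Real.pi_pos.le (by linarith)
  have hb0 : (0 : ℝ) ≤ 4 / 3 * Real.pi * 2 ^ 3 := by positivity
  have hlow : ENNReal.ofReal (2 * (Real.pi * (24 * Real.sqrt 3 - 32)) - 4 / 3 * Real.pi * 2 ^ 3) ≤
      volume (W₁ ∩ W₂ ∩ Bl) := by
    refine le_trans ?_ (measure_mono hsub)
    rw [ENNReal.ofReal_sub _ hb0]
    refine tsub_le_iff_right.2 ?_
    have h2a : ENNReal.ofReal (2 * (Real.pi * (24 * Real.sqrt 3 - 32))) ≤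
        volume (W₁ ∩ Bl) + volume (W₂ ∩ Bl) := by
      rw [two_mul, ENNReal.ofReal_add ha0 ha0]
      exact add_le_add hK₁ hK₂
    calc ENNReal.ofReal (2 * (Real.pi * (24 * Real.sqrt 3 - 32)))
        ≤ volume (W₁ ∩ Bl) + volume (W₂ ∩ Bl) := h2a
      _ = volume (W₁ ∩ Bl ∪ W₂ ∩ Bl) + volume (W₁ ∩ Bl ∩ (W₂ ∩ Bl)) := hIE.symm
      _ ≤ ENNReal.ofReal (4 / 3 * Real.pi * 2 ^ 3) + volume (W₁ ∩ Bl ∩ (W₂ ∩ Bl)) := by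
          gcongr
      _ = volume (W₁ ∩ Bl ∩ (W₂ ∩ Bl)) + ENNReal.ofReal (4 / 3 * Real.pi * 2 ^ 3) := add_comm _ _
  have hfin : volume (W₁ ∩ W₂ ∩ Bl) ≠ ⊤ :=
    (lt_of_le_of_lt (measure_mono (Set.inter_subset_left.trans Set.inter_subset_left))
      (isCompact_cruxWulffBody A).measure_lt_top).ne
  have hreal := (ENNReal.ofReal_le_iff_le_toReal hfin).1 hlow
  exact le_trans capOverlap_const_ge hreal

set_option maxHeartbeats 400000 in
/-- **Cut rows of the «top two + dust» LP, intrinsic form** (inradius, ball cut, two-body ball cut,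
isoperimetry of the union of the two classes).  See the module docstring. -/
theorem twinFree_topTwo_cutRows :
    let Λ : Set (EuclideanSpace ℝ (Fin 3)) := Literature.MathematicalPhysics.StatisticalMechanics.fccStacking 1 (Real.sqrt (2 / 3));
    let Brl : (ℤ → ℤ) → Set (EuclideanSpace ℝ (Fin 3)) := Literature.MathematicalPhysics.StatisticalMechanics.barlowStacking 1 (Real.sqrt (2 / 3));
    let Ax : EuclideanSpace ℝ (Fin 3) → (EuclideanSpace ℝ (Fin 3) ≃ₗᵢ[ℝ] EuclideanSpace ℝ (Fin 3)) → (EuclideanSpace ℝ (Fin 3) ≃ₗᵢ[ℝ] EuclideanSpace ℝ (Fin 3)) → Prop := fun m A B => ∃ (L : EuclideanSpace ℝ (Fin 3) ≃ₗᵢ[ℝ] EuclideanSpace ℝ (Fin 3)) (s₁ s₂ : EuclideanSpace ℝ (Fin 3)) (σ σ' : ℤ → ℤ), Literature.MathematicalPhysics.StatisticalMechanics.IsHaggSeq σ ∧ Literature.MathematicalPhysics.StatisticalMechanics.IsHaggSeq σ' ∧ L (EuclideanSpace.single (2 : Fin 3) (1 : ℝ)) = m ∧ A '' Λ ⊆ (fun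 q => L q + s₁) '' Brl σ ∧ B '' Λ ⊆ (fun q => L q + s₂) '' Brl σ';
    let CoAx : (EuclideanSpace ℝ (Fin 3) ≃ₗᵢ[ℝ] EuclideanSpace ℝ (Fin 3)) → (EuclideanSpace ℝ (Fin 3) ≃ₗᵢ[ℝ] EuclideanSpace ℝ (Fin 3)) → Prop := fun A B => ∃ m, Ax m A B;
    let Φ : EuclideanSpace ℝ (Fin 3) → ℝ := fun ν => Real.sqrt 2 / 4 * ∑ᶠ w ∈ {w ∈ Λ | ‖w‖ = 1}, |⟪w, ν⟫_ℝ|;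
    let Per : Set (EuclideanSpace ℝ (Fin 3)) → Set (EuclideanSpace ℝ (Fin 3)) → ℝ := fun K S => (⨆ (ξ : EuclideanSpace ℝ (Fin 3) → EuclideanSpace ℝ (Fin 3)) (_ : ContDiff ℝ 1 ξ ∧ HasCompactSupport ξ ∧ ∀ z, ξ z ∈ K), ENNReal.ofReal (∫ z in S, Literature.MathematicalPhysics.StatisticalMechanics.fieldDivergence ξ z)).toReal;
    let ι : Set (EuclideanSpace ℝ (Fin 3)) → Set (EuclideanSpace ℝ (Fin 3)) → Set (EuclideanSpace ℝ (Fin 3)) → ℝ := fun K S₁ S₂ => (Per K S₁ + Per K S₂ - Per K (S₁ ∪ S₂)) / 2;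
    let W : (EuclideanSpace ℝ (Fin 3) ≃ₗᵢ[ℝ] EuclideanSpace ℝ (Fin 3)) → Set (EuclideanSpace ℝ (Fin 3)) := fun A => {y | ∀ ν : EuclideanSpace ℝ (Fin 3), ⟪y, ν⟫_ℝ ≤ Φ (A.symm ν)};
    let Tex : (n : ℕ) → (Fin n → Set (EuclideanSpace ℝ (Fin 3))) → (Fin n → (EuclideanSpace ℝ (Fin 3) ≃ₗᵢ[ℝ] EuclideanSpace ℝ (Fin 3))) → (Fin n → Fin n → ℝ) → (Fin n → Fin n → EuclideanSpace ℝ (Fin 3)) → Prop := fun n G A c m => (∀ f : Fin n, Literature.MathematicalPhysics.StatisticalMechanics.HasFinitePerimeter (G f) ∧ volume (G f) < ⊤) ∧ (∀ f g, f ≠ g → Disjoint (G f) (G g)) ∧ (∀ f g, f ≠ g → 0 ≤ c f g) ∧ (∀ f g, f ≠ g → ¬ CoAx (A f) (A g) → m f g = 0 ∧ 1 ≤ c f g) ∧ (∀ f g, f ≠ g → CoAx (A f) (A g) → A f '' Λ ≠ A g '' Λ → Ax (m f g) (A f) (A g) ∧ 1 / 2 ≤ c f g);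
    let Vol : (n : ℕ) → (Fin n → Set (EuclideanSpace ℝ (Fin 3))) → ℝ := fun n G => (volume (⋃ f : Fin n, G f)).toReal;
    let Poly : Set (EuclideanSpace ℝ (Fin 3)) → Prop := fun S => ∃ (k : ℕ) (H : Fin k → Finset ((EuclideanSpace ℝ (Fin 3)) × ℝ)), S = ⋃ i, ⋂ p ∈ H i, {x | ⟪p.1, x⟫_ℝ < p.2};
    ∀ (n : ℕ) (G : Fin n → Set (EuclideanSpace ℝ (Fin 3))) (A : Fin n → (EuclideanSpace ℝ (Fin 3) ≃ₗᵢ[ℝ] EuclideanSpace ℝ (Fin 3))) (c : Fin n → Fin n → ℝ) (m : Fin n → Fin n → EuclideanSpace ℝ (Fin 3)) (f₁ f₂ : Fin n), Tex n G A c m → (∀ f, Poly (G f)) → A f₂ '' Λ ≠ A f₁ '' Λ →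
      (∀ f, 0 ≤ (Per (Metric.closedBall (0 : EuclideanSpace ℝ (Fin 3)) 1) (G f) - ∑ g, (if f = g then 0 else ι (Metric.closedBall (0 : EuclideanSpace ℝ (Fin 3)) 1) (G f) (G g))) ∧
        Real.sqrt 3 * (Per (Metric.closedBall (0 : EuclideanSpace ℝ (Fin 3)) 1) (G f) - ∑ g, (if f = g then 0 else ι (Metric.closedBall (0 : EuclideanSpace ℝ (Fin 3)) 1) (G f) (G g))) ≤ (Per (W (A f)) (G f) - ∑ g, (if f = g then 0 else ι (W (A f)) (G f) (G g)))) ∧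
      (∀ f g, 0 ≤ (if f = g then 0 else ι (Metric.closedBall (0 : EuclideanSpace ℝ (Fin 3)) 1) (G f) (G g))) ∧
      (3 * (Real.pi * (24 * Real.sqrt 3 - 32)) ^ ((1 : ℝ) / 3) * (Vol n G) ^ ((2 : ℝ) / 3) ≤
        (∑ f ∈ Finset.univ.filter (fun f => A f '' Λ = A f₁ '' Λ), (Per (W (A f)) (G f) - ∑ g, (if f = g then 0 else ι (W (A f)) (G f) (G g)))) +
          2 * ∑ f ∈ Finset.univ \ Finset.univ.filter (fun f => A f '' Λ = A f₁ '' Λ), (Per (Metric.closedBall (0 : EuclideanSpace ℝ (Fin 3)) 1) (G f) - ∑ g, (if f = g then 0 else ι (Metric.closedBall (0 : EuclideanSpace ℝ (Fin 3)) 1) (G f) (G g)))) ∧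
      (3 * (26.61 : ℝ) ^ ((1 : ℝ) / 3) * (Vol n G) ^ ((2 : ℝ) / 3) ≤
        (∑ f ∈ Finset.univ.filter (fun f => A f '' Λ = A f₁ '' Λ), (Per (W (A f)) (G f) - ∑ g, (if f = g then 0 else ι (W (A f)) (G f) (G g)))) +
          (∑ f ∈ Finset.univ.filter (fun f => A f '' Λ = A f₂ '' Λ), (Per (W (A f)) (G f) - ∑ g, (if f = g then 0 else ι (W (A f)) (G f) (G g)))) +
          2 * ∑ f ∈ Finset.univ \ (Finset.univ.filter (fun f => A f '' Λ = A f₁ '' Λ) ∪ Finset.univ.filter (fun f => A f '' Λ = A f₂ '' Λ)), (Per (Metric.closedBall (0 : EuclideanSpace ℝ (Fin 3)) 1) (G f) - ∑ g, (if f = g then 0 else ι (Metric.closedBall (0 : EuclideanSpace ℝ (Fin 3)) 1) (G f) (G g)))) ∧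
      (3 * (Real.pi * 4 / 3) ^ ((1 : ℝ) / 3) * (volume (⋃ f ∈ Finset.univ.filter (fun f => A f '' Λ = A f₁ '' Λ) ∪ Finset.univ.filter (fun f => A f '' Λ = A f₂ '' Λ), G f)).toReal ^ ((2 : ℝ) / 3) ≤
        (∑ f ∈ Finset.univ.filter (fun f => A f '' Λ = A f₁ '' Λ) ∪ Finset.univ.filter (fun f => A f '' Λ = A f₂ '' Λ), (Per (Metric.closedBall (0 : EuclideanSpace ℝ (Fin 3)) 1) (G f) - ∑ g, (if f = g then 0 else ι (Metric.closedBall (0 : EuclideanSpace ℝ (Fin 3)) 1) (G f) (G g)))) +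
          ∑ f ∈ Finset.univ.filter (fun f => A f '' Λ = A f₁ '' Λ) ∪ Finset.univ.filter (fun f => A f '' Λ = A f₂ '' Λ), ∑ g ∈ Finset.univ \ (Finset.univ.filter (fun f => A f '' Λ = A f₁ '' Λ) ∪ Finset.univ.filter (fun f => A f '' Λ = A f₂ '' Λ)), (if f = g then 0 else ι (Metric.closedBall (0 : EuclideanSpace ℝ (Fin 3)) 1) (G f) (G g))) := by
  intro Λ Brl Ax CoAx Φ Per ι W Tex Vol Poly n G A c m f₁ f₂ hTex hPoly hne
  have eP : ∀ K S, Per K S = per K S := fun _ _ => rfl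
  have eι : ∀ K S₁ S₂, ι K S₁ S₂ = (per K S₁ + per K S₂ - per K (S₁ ∪ S₂)) / 2 := fun _ _ _ => rfl
  simp only [eι, eP]
  classical
  obtain ⟨hfin, hdisj, -, -, -⟩ := id hTex
  have hvol : ∀ f, volume (G f) < ⊤ := fun f => (hfin f).2
  obtain ⟨hEm, hEv, hEp, -⟩ := texture_union_facts G hfin hdisj
  -- lattice classes `C₁ ∋ f₁`, `C₂ ∋ f₂`, the rest `R`
  set lat : Fin n → Set E3 := fun f => A f '' Λ with hlat
  set C₁ : Finset (Fin n) := Finset.univ.filter (fun f => lat f = lat f₁) with hC₁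
  set C₂ : Finset (Fin n) := Finset.univ.filter (fun f => lat f = lat f₂) with hC₂
  set R : Finset (Fin n) := Finset.univ \ (C₁ ∪ C₂) with hR
  have hmem₁ : ∀ f, f ∈ C₁ ↔ lat f = lat f₁ := fun f => by simp [hC₁]
  have hmem₂ : ∀ f, f ∈ C₂ ↔ lat f = lat f₂ := fun f => by simp [hC₂]
  have hne' : lat f₂ ≠ lat f₁ := hne
  have h12 : ∀ f, f ∈ C₁ → f ∉ C₂ := fun f h1 h2 => hne' (((hmem₂ f).1 h2).symm.trans ((hmem₁ f).1 h1))
  have hmemR : ∀ f, f ∈ R ↔ f ∉ C₁ ∧ f ∉ C₂ := fun f => by simp [hR]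
  have hBallc : ∀ r : ℝ, IsCompact (Metric.closedBall (0 : E3) r) := fun r => isCompact_closedBall 0 r
  have hBallv : ∀ r : ℝ, Convex ℝ (Metric.closedBall (0 : E3) r) := fun r => convex_closedBall 0 r
  have hBall0 : ∀ {r : ℝ}, 0 ≤ r → (0 : E3) ∈ Metric.closedBall (0 : E3) r := fun hr =>
    Metric.mem_closedBall_self hr
  have hBalls : ∀ r : ℝ, -Metric.closedBall (0 : E3) r = Metric.closedBall 0 r := fun r => by
    rw [neg_closedBall, neg_zero]
  have hBc := hBallc 1; have hBv := hBallv 1; have hBs := hBalls 1; have hB0 : (0 : E3) ∈ Metric.closedBall (0 : E3) 1 := hBall0 zero_le_one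
  have h30 : (0 : ℝ) ≤ Real.sqrt 3 := Real.sqrt_nonneg 3; have h50 : (0 : ℝ) ≤ Real.sqrt 5 := Real.sqrt_nonneg 5; obtain ⟨h3pos, h5pos⟩ : (0 : ℝ) < Real.sqrt 3 ∧ (0 : ℝ) < Real.sqrt 5 := ⟨by positivity, by positivity⟩
  have hWc : ∀ f, IsCompact (W (A f)) := fun f => isCompact_cruxWulffBody (A f)
  have hWv : ∀ f, Convex ℝ (W (A f)) := fun f => convex_cruxWulffBody (A f)
  have hW0 : ∀ f, (0 : E3) ∈ W (A f) := fun f => zero_mem_cruxWulffBody (A f); have hWs : ∀ f, -W (A f) = W (A f) := fun f => neg_cruxWulffBody_eq (A f)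
  have hW5 : ∀ f, W (A f) ⊆ Metric.closedBall (0 : E3) (Real.sqrt 5) := fun f =>
    cruxWulffBody_subset_closedBall (A f)
  have hW3 : ∀ f, Metric.closedBall (0 : E3) (Real.sqrt 3) ⊆ W (A f) := fun f =>
    closedBall_subset_cruxWulffBody (A f)
  have hWeq : ∀ f g, lat f = lat g → W (A f) = W (A g) := fun f g h => wulffBody_eq_of_image_eq h
  set K₁ : Set E3 := W (A f₁) with hK₁
  set K₂ : Set E3 := W (A f₂) with hK₂
  have hKC₁ : ∀ f ∈ C₁, W (A f) = K₁ := fun f hf => hWeq f f₁ ((hmem₁ f).1 hf)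
  have hKC₂ : ∀ f ∈ C₂, W (A f) = K₂ := fun f hf => hWeq f f₂ ((hmem₂ f).1 hf)
  have hperBr : ∀ {r : ℝ}, 0 < r → ∀ S : Set E3, per (Metric.closedBall (0 : E3) r) S =
      r * per (Metric.closedBall (0 : E3) 1) S := by
    intro r hr S
    rw [per_closedBall_eq_mul_perimeter hr, per_closedBall_eq_mul_perimeter one_pos, one_mul]
  -- one common refinement: walls / exterior / total clauses
  obtain ⟨k, H, ν, S, SX, hcross, hext, htot⟩ := exists_exterior_crossSums G hPoly hvol hdisj
  set X : Set E3 → Fin k → Fin k → ℝ := fun K a b =>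
    (if a < b then (supportFn K (ν a b) + supportFn K (-ν a b)) *
        facetArea (closure (polytope (H a)) ∩ closure (polytope (H b))) (ν a b)
      else (supportFn K (ν b a) + supportFn K (-ν b a)) *
        facetArea (closure (polytope (H b)) ∩ closure (polytope (H a))) (ν b a)) with hX
  -- the free energy of a grain w.r.t. a symmetric body `K` is half its exterior cross sum
  have hfree : ∀ K : Set E3, IsCompact K → Convex ℝ K → (0 : E3) ∈ K → -K = K → ∀ f,
      per K (G f) - ∑ g, (if f = g then 0 else (per K (G f) + per K (G g) - per K (G f ∪ G g)) / 2) =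
        (∑ a ∈ S f, ∑ b ∈ SX, X K a b) / 2 := by
    intro K hK hKv hK0 hKs f
    have h : 2 * per K (G f) = (∑ g ∈ Finset.univ.erase f,
        (per K (G f) + per K (G g) - per K (G f ∪ G g))) + ∑ a ∈ S f, ∑ b ∈ SX, X K a b :=
      hext K hK hKv hK0 hKs f
    rw [sum_ite_eq_sum_erase_div_two]
    linarith
  have hmono : ∀ {K K' : Set E3}, K ⊆ K' → Bornology.IsBounded K' → K.Nonempty → ∀ f,
      (∑ a ∈ S f, ∑ b ∈ SX, X K a b) ≤ ∑ a ∈ S f, ∑ b ∈ SX, X K' a b :=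
    fun hKK' hK' hKne f => crossSum_mono hKK' hK' hKne H ν (S f) SX
  have hcs0 : ∀ {K : Set E3}, IsCompact K → (0 : E3) ∈ K → ∀ f, 0 ≤ ∑ a ∈ S f, ∑ b ∈ SX, X K a b :=
    fun hK hK0 f => crossSum_nonneg hK hK0 H ν (S f) SX
  -- exterior areas `Y f` (unit ball) and their scaling
  set Y : Fin n → ℝ := fun f => (∑ a ∈ S f, ∑ b ∈ SX, X (Metric.closedBall (0 : E3) 1) a b) / 2 with hY
  have hYdef : ∀ f, Y f = (∑ a ∈ S f, ∑ b ∈ SX, X (Metric.closedBall (0 : E3) 1) a b) / 2 :=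
    fun f => rfl
  have hY0 : ∀ f, 0 ≤ Y f := fun f => by rw [hYdef]; exact div_nonneg (hcs0 hBc hB0 f) zero_le_two
  have hscale : ∀ {r : ℝ}, 0 < r → ∀ f,
      (∑ a ∈ S f, ∑ b ∈ SX, X (Metric.closedBall (0 : E3) r) a b) / 2 = r * Y f := by
    intro r hr f
    rw [hYdef, ← hfree _ (hBallc r) (hBallv r) (hBall0 hr.le) (hBalls r) f,
      ← hfree _ hBc hBv hB0 hBs f]
    simp_rw [hperBr hr]
    rw [mul_sub, Finset.mul_sum]
    congr 1
    refine Finset.sum_congr rfl fun g _ => ?_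
    split_ifs <;> ring
  -- a grain's free energy is at least `√3 · Y f`; its `K₀`-free energy is at most `√5 · Y f`
  have hfree_ge : ∀ f, Real.sqrt 3 * Y f ≤ (∑ a ∈ S f, ∑ b ∈ SX, X (W (A f)) a b) / 2 := by
    intro f
    rw [← hscale h3pos f]
    exact div_le_div_of_nonneg_right (hmono (hW3 f) (hWc f).isBounded ⟨0, hBall0 h30⟩ f) zero_le_two
  -- the unit-ball interface terms `w`
  set w : Fin n → Fin n → ℝ := fun f g => if f = g then 0 else
    (per (Metric.closedBall (0 : E3) 1) (G f) + per (Metric.closedBall (0 : E3) 1) (G g) -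
      per (Metric.closedBall (0 : E3) 1) (G f ∪ G g)) / 2 with hw
  have hw0 : ∀ f g, 0 ≤ w f g := by
    intro f g
    by_cases hfg : f = g
    · simp only [hw, hfg, if_true]; exact le_rfl
    · simp only [hw, hfg, if_false]
      exact div_nonneg (iota_nonneg_of_poly G hPoly hvol hdisj hBc hBv hB0 hfg) zero_le_two
  have hwsymm : ∀ f g, w f g = w g f := fun f g => iota_kernel_symm _ G f g
  -- `per_B (G f) = Σ_g w f g + Y f`
  have hperY : ∀ f, per (Metric.closedBall (0 : E3) 1) (G f) = (∑ g, w f g) + Y f := by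
    intro f
    have h := hfree _ hBc hBv hB0 hBs f
    have hY' := hYdef f
    simp only [hw]
    linarith
  have hsplitI : ∀ (I : Finset (Fin n)) (F : Fin n → ℝ), (∑ f, F f) = (∑ f ∈ I, F f) + ∑ f ∈ Finset.univ \ I, F f := by
    intro I F
    rw [← Finset.sum_sdiff (Finset.subset_univ I), add_comm]
  -- the intrinsic exterior areas are the `Y f`
  have hYF : ∀ f, per (Metric.closedBall (0 : E3) 1) (G f) - ∑ g, (if f = g then 0 else
      (per (Metric.closedBall (0 : E3) 1) (G f) + per (Metric.closedBall (0 : E3) 1) (G g) -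
        per (Metric.closedBall (0 : E3) 1) (G f ∪ G g)) / 2) = Y f :=
    fun f => hfree _ hBc hBv hB0 hBs f
  simp only [hYF]
  -- INRADIUS rows and nonnegativity
  have hδ : ∀ f, 0 ≤ Y f ∧ Real.sqrt 3 * Y f ≤ per (W (A f)) (G f) - ∑ g, (if f = g then 0 else
      (per (W (A f)) (G f) + per (W (A f)) (G g) - per (W (A f)) (G f ∪ G g)) / 2) := fun f =>
    ⟨hY0 f, by rw [hfree _ (hWc f) (hWv f) (hW0 f) (hWs f) f]; exact hfree_ge f⟩
  -- a ball-cut body and its free-energy bound, for a family of bodies constant `= K` on `I`, `B̄(0,2)` off `I`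
  set Bl : Set E3 := Metric.closedBall (0 : E3) 2 with hBl
  have hcut : ∀ (L : Set E3), IsCompact L → Convex ℝ L → (0 : E3) ∈ L → -L = L →
      ∀ (Kb : Fin n → Set E3), (∀ f, IsCompact (Kb f) ∧ Convex ℝ (Kb f) ∧ (0 : E3) ∈ Kb f ∧ -Kb f = Kb f ∧ L ⊆ Kb f) →
      3 * (volume L).toReal ^ ((1 : ℝ) / 3) * Vol n G ^ ((2 : ℝ) / 3) ≤
        ∑ f, (per (Kb f) (G f) - ∑ g, (if f = g then 0 else
          (per (Kb f) (G f) + per (Kb f) (G g) - per (Kb f) (G f ∪ G g)) / 2)) := by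
    intro L hLc hLv hL0 hLs Kb hKb
    exact (wulff_le_per hLc hLv hL0 ⟨hEm, lt_top_iff_ne_top.2 hEp⟩ hEv).trans
      (per_iUnion_le_freeEnergy G hPoly hvol hdisj Kb (fun f => (hKb f).1) (fun f => (hKb f).2.1)
        (fun f => (hKb f).2.2.1) (fun f => (hKb f).2.2.2.1) hLc hLv hL0 hLs (fun f => (hKb f).2.2.2.2))
  have hFrBl : ∀ f, per Bl (G f) - ∑ g, (if f = g then 0 else
      (per Bl (G f) + per Bl (G g) - per Bl (G f ∪ G g)) / 2) = 2 * Y f := fun f => by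
    rw [hfree _ (hBallc 2) (hBallv 2) (hBall0 zero_le_two) (hBalls 2) f, hscale two_pos f]
  have ha0 : 0 ≤ Real.pi * (24 * Real.sqrt 3 - 32) := by
    have h3 := sqrt_three_lower_fine
    exact mul_nonneg Real.pi_pos.le (by linarith)
  have hVnn : 0 ≤ Vol n G := ENNReal.toReal_nonneg
  have hV23 : 0 ≤ Vol n G ^ ((2 : ℝ) / 3) := Real.rpow_nonneg hVnn _
  -- BALL CUT on `C₁`
  have hε₁ : 3 * (Real.pi * (24 * Real.sqrt 3 - 32)) ^ ((1 : ℝ) / 3) * Vol n G ^ ((2 : ℝ) / 3) ≤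
      (∑ f ∈ C₁, (per (W (A f)) (G f) - ∑ g, (if f = g then 0 else
        (per (W (A f)) (G f) + per (W (A f)) (G g) - per (W (A f)) (G f ∪ G g)) / 2))) +
        2 * ∑ f ∈ Finset.univ \ C₁, Y f := by
    set L : Set E3 := K₁ ∩ Bl with hL
    have hLc : IsCompact L := (hWc f₁).inter (hBallc 2)
    set Kb : Fin n → Set E3 := fun f => if f ∈ C₁ then K₁ else Bl with hKb
    have hKbP : ∀ f, IsCompact (Kb f) ∧ Convex ℝ (Kb f) ∧ (0 : E3) ∈ Kb f ∧ -Kb f = Kb f ∧ L ⊆ Kb f := by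
      intro f
      by_cases hf : f ∈ C₁
      · simp only [hKb, hf, if_true]
        exact ⟨hWc f₁, hWv f₁, hW0 f₁, hWs f₁, Set.inter_subset_left⟩
      · simp only [hKb, hf, if_false]
        exact ⟨hBallc 2, hBallv 2, hBall0 zero_le_two, hBalls 2, Set.inter_subset_right⟩
    have h := hcut L hLc ((hWv f₁).inter (hBallv 2)) ⟨hW0 f₁, hBall0 zero_le_two⟩
      (by rw [hL, Set.inter_neg, hWs f₁, hBalls 2]) Kb hKbP
    rw [hsplitI C₁] at h
    have e1 : (∑ f ∈ C₁, (per (Kb f) (G f) - ∑ g, (if f = g then 0 else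
        (per (Kb f) (G f) + per (Kb f) (G g) - per (Kb f) (G f ∪ G g)) / 2))) =
        ∑ f ∈ C₁, (per (W (A f)) (G f) - ∑ g, (if f = g then 0 else
        (per (W (A f)) (G f) + per (W (A f)) (G g) - per (W (A f)) (G f ∪ G g)) / 2)) :=
      Finset.sum_congr rfl fun f hf => by simp only [hKb, hf, if_true]; rw [hKC₁ f hf]
    have e2 : (∑ f ∈ Finset.univ \ C₁, (per (Kb f) (G f) - ∑ g, (if f = g then 0 else
        (per (Kb f) (G f) + per (Kb f) (G g) - per (Kb f) (G f ∪ G g)) / 2))) =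
        2 * ∑ f ∈ Finset.univ \ C₁, Y f := by
      rw [Finset.mul_sum]
      refine Finset.sum_congr rfl fun f hf => ?_
      simp only [hKb, (Finset.mem_sdiff.1 hf).2, if_false]
      exact hFrBl f
    rw [e1, e2] at h
    have hLvol : Real.pi * (24 * Real.sqrt 3 - 32) ≤ (volume L).toReal :=
      (ENNReal.ofReal_le_iff_le_toReal hLc.measure_lt_top.ne).1
        (volume_cruxWulffBody_inter_closedBall_two_ge (A f₁))
    have hroot : (Real.pi * (24 * Real.sqrt 3 - 32)) ^ ((1 : ℝ) / 3) ≤ (volume L).toReal ^ ((1 : ℝ) / 3) :=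
      Real.rpow_le_rpow ha0 hLvol (by norm_num)
    exact (mul_le_mul_of_nonneg_right (mul_le_mul_of_nonneg_left hroot (by norm_num)) hV23).trans h
  -- TWO-BODY BALL CUT on `C₁`, `C₂`
  have hR' : Finset.univ \ C₁ = C₂ ∪ R := by
    ext f
    simp only [Finset.mem_sdiff, Finset.mem_univ, true_and, Finset.mem_union, hmemR]
    constructor
    · intro hf
      by_cases h2 : f ∈ C₂
      · exact Or.inl h2
      · exact Or.inr ⟨hf, h2⟩
    · rintro (h2 | ⟨h1, -⟩)
      · exact fun h1 => h12 f h1 h2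
      · exact h1
  have hdisj2R : Disjoint C₂ R := Finset.disjoint_left.2 fun f h2 hr => ((hmemR f).1 hr).2 h2
  have hε₁₂ : 3 * (26.61 : ℝ) ^ ((1 : ℝ) / 3) * Vol n G ^ ((2 : ℝ) / 3) ≤
      (∑ f ∈ C₁, (per (W (A f)) (G f) - ∑ g, (if f = g then 0 else
        (per (W (A f)) (G f) + per (W (A f)) (G g) - per (W (A f)) (G f ∪ G g)) / 2))) +
      (∑ f ∈ C₂, (per (W (A f)) (G f) - ∑ g, (if f = g then 0 else
        (per (W (A f)) (G f) + per (W (A f)) (G g) - per (W (A f)) (G f ∪ G g)) / 2))) +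
        2 * ∑ f ∈ R, Y f := by
    set L : Set E3 := K₁ ∩ K₂ ∩ Bl with hL
    have hLc : IsCompact L := ((hWc f₁).inter (hWc f₂)).inter (hBallc 2)
    set Kb : Fin n → Set E3 := fun f => if f ∈ C₁ then K₁ else if f ∈ C₂ then K₂ else Bl with hKb
    have hKbP : ∀ f, IsCompact (Kb f) ∧ Convex ℝ (Kb f) ∧ (0 : E3) ∈ Kb f ∧ -Kb f = Kb f ∧ L ⊆ Kb f := by
      intro f
      by_cases hf : f ∈ C₁
      · simp only [hKb, hf, if_true]
        exact ⟨hWc f₁, hWv f₁, hW0 f₁, hWs f₁, Set.inter_subset_left.trans Set.inter_subset_left⟩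
      · by_cases hf2 : f ∈ C₂
        · simp only [hKb, hf, hf2, if_false, if_true]
          exact ⟨hWc f₂, hWv f₂, hW0 f₂, hWs f₂, Set.inter_subset_left.trans Set.inter_subset_right⟩
        · simp only [hKb, hf, hf2, if_false]
          exact ⟨hBallc 2, hBallv 2, hBall0 zero_le_two, hBalls 2, Set.inter_subset_right⟩
    have h := hcut L hLc (((hWv f₁).inter (hWv f₂)).inter (hBallv 2))
      ⟨⟨hW0 f₁, hW0 f₂⟩, hBall0 zero_le_two⟩
      (by rw [hL, Set.inter_neg, Set.inter_neg, hWs f₁, hWs f₂, hBalls 2]) Kb hKbP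
    rw [hsplitI C₁, hR', Finset.sum_union hdisj2R] at h
    have e1 : (∑ f ∈ C₁, (per (Kb f) (G f) - ∑ g, (if f = g then 0 else
        (per (Kb f) (G f) + per (Kb f) (G g) - per (Kb f) (G f ∪ G g)) / 2))) =
        ∑ f ∈ C₁, (per (W (A f)) (G f) - ∑ g, (if f = g then 0 else
        (per (W (A f)) (G f) + per (W (A f)) (G g) - per (W (A f)) (G f ∪ G g)) / 2)) :=
      Finset.sum_congr rfl fun f hf => by simp only [hKb, hf, if_true]; rw [hKC₁ f hf]
    have e2 : (∑ f ∈ C₂, (per (Kb f) (G f) - ∑ g, (if f = g then 0 else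
        (per (Kb f) (G f) + per (Kb f) (G g) - per (Kb f) (G f ∪ G g)) / 2))) =
        ∑ f ∈ C₂, (per (W (A f)) (G f) - ∑ g, (if f = g then 0 else
        (per (W (A f)) (G f) + per (W (A f)) (G g) - per (W (A f)) (G f ∪ G g)) / 2)) :=
      Finset.sum_congr rfl fun f hf => by
        have hf1 : f ∉ C₁ := fun h1 => h12 f h1 hf
        simp only [hKb, hf1, hf, if_false, if_true]; rw [hKC₂ f hf]
    have e3 : (∑ f ∈ R, (per (Kb f) (G f) - ∑ g, (if f = g then 0 else
        (per (Kb f) (G f) + per (Kb f) (G g) - per (Kb f) (G f ∪ G g)) / 2))) = 2 * ∑ f ∈ R, Y f := by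
      rw [Finset.mul_sum]
      refine Finset.sum_congr rfl fun f hf => ?_
      simp only [hKb, ((hmemR f).1 hf).1, ((hmemR f).1 hf).2, if_false]
      exact hFrBl f
    rw [e1, e2, e3] at h
    have hLvol : (26.61 : ℝ) ≤ (volume L).toReal := volume_cruxWulffBody_inter_inter_closedBall_ge (A f₁) (A f₂)
    have hroot : (26.61 : ℝ) ^ ((1 : ℝ) / 3) ≤ (volume L).toReal ^ ((1 : ℝ) / 3) :=
      Real.rpow_le_rpow (by norm_num) hLvol (by norm_num)
    have := (mul_le_mul_of_nonneg_right (mul_le_mul_of_nonneg_left hroot (by norm_num)) hV23).trans h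
    linarith
  -- ISOPERIMETRY of `C₁ ∪ C₂`
  have hfactsU := subfamily_union_facts G hfin hdisj (C₁ ∪ C₂)
  have hisoU := isoperimetric_toReal_three hfactsU.1 hfactsU.2.1 hfactsU.2.2.1
  have hperB : ∀ S : Set E3, per (Metric.closedBall (0 : E3) 1) S = (perimeter S).toReal := fun S => by
    rw [per_closedBall_eq_mul_perimeter one_pos S, one_mul]
  have hPerU : (perimeter (⋃ f ∈ C₁ ∪ C₂, G f)).toReal =
      (∑ f ∈ C₁ ∪ C₂, Y f) + ∑ f ∈ C₁ ∪ C₂, ∑ g ∈ Finset.univ \ (C₁ ∪ C₂), w f g := by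
    have hIE : per (Metric.closedBall (0 : E3) 1) (⋃ f ∈ C₁ ∪ C₂, G f) =
        (∑ f ∈ C₁ ∪ C₂, per (Metric.closedBall (0 : E3) 1) (G f)) -
          ∑ f ∈ C₁ ∪ C₂, ∑ g ∈ C₁ ∪ C₂, w f g :=
      per_biUnion_eq_sum_sub_sum_iota G hPoly hvol hdisj hBc hBv hB0 hBs (C₁ ∪ C₂)
    have e4 : (∑ f ∈ C₁ ∪ C₂, per (Metric.closedBall (0 : E3) 1) (G f)) =
        (∑ f ∈ C₁ ∪ C₂, ∑ g, w f g) + ∑ f ∈ C₁ ∪ C₂, Y f := by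
      rw [← Finset.sum_add_distrib]
      exact Finset.sum_congr rfl fun f _ => hperY f
    have e5 : (∑ f ∈ C₁ ∪ C₂, ∑ g, w f g) = (∑ f ∈ C₁ ∪ C₂, ∑ g ∈ C₁ ∪ C₂, w f g) +
        ∑ f ∈ C₁ ∪ C₂, ∑ g ∈ Finset.univ \ (C₁ ∪ C₂), w f g := by
      rw [← Finset.sum_add_distrib]
      exact Finset.sum_congr rfl fun f _ => hsplitI (C₁ ∪ C₂) (w f)
    rw [← hperB, hIE]
    linarith
  rw [hPerU] at hisoU
  refine ⟨hδ, hw0, hε₁, hε₁₂, ?_⟩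
  simpa only [hw] using hisoU

end Summit.Ventures.Crystal3D.Cruxes.PolycrystalWulffBound.PolyDensity

end
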